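import Literature.Barriers.SmoothPoincare4.ExoticContractibleBoundaryDiffeosProofs
import Literature.Topology.FourManifolds.CobordismAttachmentHomeomorph
import HarnessLib

/-!
# Akbulut–Ruberman's Thm. B, and the barrier `ContractibleBarrierFour`, from a cork and Thm. A's leaves WITHOUT Freedman's theorem

Sibling proof file of `Literature/Barriers/SmoothPoincare4/ExoticContractible.lean` (barrier
`Literature.Barriers.SmoothPoincare4.ContractibleBarrierFour`; fact seat, approach B: an
independent decomposition of the printed proof). Everything here is PROVED; no definitions, no
named facts.

## The point

The printed proofs (S. Akbulut, D. Ruberman, *Absolutely exotic compact 4-manifolds*, Comment.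
Math. Helv. 91 (2016), §3) obtain the HOMEOMORPHISM `V ≃ V′` of the absolutely exotic pair from
Freedman's classification — proof of Thm. A: "Since `V` and `V′` are simply connected homology
balls, they are contractible, hence homeomorphic"; proof of Thm. B: "But Freedman's theorem says
that `V` and `V′` are in fact homeomorphic" — vendored in the tree as the named fact
`freedmanQuinn1990_homeomorph_extends_contractible` (Freedman–Quinn 11.1C / 9.3C), a hypothesis
`hF` of every assembly of the barrier along this route so far
(`contractibleBarrierFour_of_parts`, `…_of_cork_symmetryKilling_relativelyExotic_freedmanQuinn`,
`contractibleBarrierFour_of_theoremA`, …).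

That appeal is unnecessary when, as in the proof of Thm. B, the input of Thm. A is a CORK
`(W, f)`: by definition the boundary diffeomorphism `f` of a cork extends to a self-homeomorphism
`F` of `W` (Akbulut–Ruberman §1: "a diffeomorphism `f : ∂W → ∂W` which does not extend to a
self-diffeomorphism of `W`, although it does extend to a self-homeomorphism `F : W → W`"; the
tree's `akbulut1991_mazurCork` carries `ExtendsToHomeomorph b f`, and Thm. A's own hypothesis is
"`F : W → W` a homeomorphism whose restriction to `M = ∂W` is a diffeomorphism"). The pair of
§§2–3 is `V = W ∪_{id} X`, `V′ = W ∪_f X` for one cobordism `X` out of `∂W` ("Cutting out the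
embedded copy of `W` in `V` and regluing via `f` results in a manifold `V′`", §2), and
**`F ∪ id_X : V′ → V` is a homeomorphism** — topological pasting along the seam, the tree's
`CobordismAttachment.exists_homeomorph_of_apply_incl_eq`
(`Literature/Topology/FourManifolds/CobordismAttachmentHomeomorph.lean`). Hence:

* `akbulutRuberman2016_construction_homeomorph_of_parts` — the construction of §§2–3 from the
  parts (C) `akbulutRuberman2016_symmetryKillingCobordism`, (G) `exists_cobordismAttachment`,
  (R) `akbulutRuberman2016_relativelyExotic`, (S) `akbulutRuberman2016_boundaryDiffeosExtend`
  (as in `akbulutRuberman2016_construction_contractible_of_parts`), now also recording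
  `V ≃ₜ V′` when `f` extends to a homeomorphism of `W`;
* `akbulutRuberman2016_theoremA_contractible_homeomorph_of_parts` — Thm. A (contractible `W`)
  with the conclusion "`V`, `V′` homeomorphic" added, from the four parts;
* `akbulutRuberman2016_theoremB_of_cork_parts` — Thm. B from a cork and the four parts, and
  `akbulutRuberman2016_theoremB_of_cork_symmetryKilling_relativelyExotic` — from a cork, (C)
  and (R) only ((G) and (S) are the tree's theorems `exists_cobordismAttachment_holds`,
  `akbulutRuberman2016_boundaryDiffeosExtend_holds`);
* `contractibleBarrierFour_of_cork_symmetryKilling_relativelyExotic`,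
  `contractibleBarrierFour_of_isCork_symmetryKilling_relativelyExotic` — the barrier from the
  same leaves.

Net effect on the DAG of the barrier (all arrows proved): on the Akbulut–Ruberman route the leaf
set shrinks from {`akbulut1991_mazurCork`, (C), (R), `freedmanQuinn1990_homeomorph_extends_contractible`}
to {`akbulut1991_mazurCork`, (C), (R)}; Freedman's theorem enters only through the cork fact
itself (Akbulut 1991 used it to produce `F`).

## References

* S. Akbulut, D. Ruberman, *Absolutely exotic compact 4-manifolds*, Comment. Math. Helv. 91
  (2016) 1–19 = arXiv:1410.1461v3: §1 (corks), §2 (paragraph after Lemma 2.3), §3 (proofs of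
  Thms. A and B). [AkbulutRuberman2016]
* S. Akbulut, *A fake compact contractible 4-manifold*, J. Differential Geom. 33 (1991), Thms. 1-2.
  [Akbulut1991Fake]
* J. Milnor, *Lectures on the h-cobordism theorem* (1965), §1, Thm. 1.4. [MilnorHCobordism1965]
-/

noncomputable section

open scoped Manifold ContDiff
open Function Set
open Literature.Topology.FourManifolds

namespace Literature.Barriers.SmoothPoincare4

universe u

/-! ### The construction of §§2–3 with its homeomorphism -/

/-- **The construction of §§2–3 from the four parts, with the homeomorphism `V ≃ₜ V′`.** For a
compact (Hausdorff, second countable) contractible smooth 4-manifold `W` with boundary datum `b`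
and a self-diffeomorphism `f` of `∂W` that extends to a self-HOMEOMORPHISM of `W` (`hH`), the
parts (C), (G), (R), (S) of the printed proof of Thm. A give compact contractible smooth `V`, `V′`
with boundary data `bV`, `bV′`, an identification `ν : ∂V ≅ ∂V′`, a HOMEOMORPHISM `V ≃ₜ V′`, the
extension property of all boundary diffeomorphisms of `V′`, and relative exoticness (a
`ν`-compatible diffeomorphism `V ≅ V′` forces `f` to extend to a diffeomorphism of `W`). Proof:
as `akbulutRuberman2016_construction_contractible_of_parts` (`V = W ∪_{id} X`, `V′ = W ∪_f X`
for the symmetry-killing cobordism `X` of (C), attached by (G)); the homeomorphism is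
`F ∪ id_X` for a homeomorphic extension `F` of `f`
(`CobordismAttachment.exists_homeomorph_of_apply_incl_eq`) — in place of the printed "Since `V`
and `V′` are simply connected homology balls, they are contractible, hence homeomorphic" (proof
of Thm. A) / "Freedman's theorem says that `V` and `V′` are in fact homeomorphic" (proof of
Thm. B). [cite: AkbulutRuberman2016, §2 (paragraph after Lemma 2.3) and §3 (proofs of Thms. A, B)] -/
theorem akbulutRuberman2016_construction_homeomorph_of_parts
    (hC : akbulutRuberman2016_symmetryKillingCobordism.{u})
    (hG : exists_cobordismAttachment.{u})
    (hR : akbulutRuberman2016_relativelyExotic.{u})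
    (hS : akbulutRuberman2016_boundaryDiffeosExtend.{u})
    (W : Type u) [TopologicalSpace W] [T2Space W] [SecondCountableTopology W]
    [ChartedSpace (EuclideanHalfSpace 4) W] [IsManifold (𝓡∂ 4) ∞ W] [CompactSpace W]
    [ContractibleSpace W] (b : BoundaryData (𝓡∂ 4) W (𝓡 3))
    (f : b.carrier ≃ₘ⟮𝓡 3, 𝓡 3⟯ b.carrier) (hH : ExtendsToHomeomorph b f) :
    ∃ (V V' : Type u) (_ : TopologicalSpace V) (_ : T2Space V) (_ : SecondCountableTopology V)
      (_ : ChartedSpace (EuclideanHalfSpace 4) V) (_ : IsManifold (𝓡∂ 4) ∞ V) (_ : CompactSpace V)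
      (_ : ContractibleSpace V)
      (_ : TopologicalSpace V') (_ : T2Space V') (_ : SecondCountableTopology V')
      (_ : ChartedSpace (EuclideanHalfSpace 4) V') (_ : IsManifold (𝓡∂ 4) ∞ V')
      (_ : CompactSpace V') (_ : ContractibleSpace V')
      (bV : BoundaryData (𝓡∂ 4) V (𝓡 3)) (bV' : BoundaryData (𝓡∂ 4) V' (𝓡 3))
      (ν : bV.carrier ≃ₘ⟮𝓡 3, 𝓡 3⟯ bV'.carrier),
      Nonempty (V ≃ₜ V') ∧
      (∀ g : bV'.carrier ≃ₘ⟮𝓡 3, 𝓡 3⟯ bV'.carrier, ExtendsToDiffeomorph bV' g) ∧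
      ∀ Φ : V ≃ₘ⟮𝓡∂ 4, 𝓡∂ 4⟯ V', (∀ z, Φ (bV.incl z) = bV'.incl (ν z)) →
        ExtendsToDiffeomorph b f := by
  obtain ⟨N, _, _, _, X, hInv, hFar, hContr⟩ := hC W b
  obtain ⟨V, _, _, _, _, _, ⟨A⟩⟩ :=
    exists_cobordismAttachment_four hG W b b.carrier N X (Diffeomorph.refl (𝓡 3) b.carrier ∞)
  obtain ⟨V', _, _, _, _, _, ⟨A'⟩⟩ := exists_cobordismAttachment_four hG W b b.carrier N X f
  haveI : CompactSpace V := A.compactSpace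
  haveI : CompactSpace V' := A'.compactSpace
  haveI : ContractibleSpace V := hContr _ V ⟨A⟩
  haveI : ContractibleSpace V' := hContr f V' ⟨A'⟩
  obtain ⟨F, hF⟩ := hH
  obtain ⟨Θ, -, -⟩ := A.exists_homeomorph_of_apply_incl_eq A' F hF
  refine ⟨V, V', ‹_›, ‹_›, ‹_›, ‹_›, ‹_›, ‹_›, ‹_›, ‹_›, ‹_›, ‹_›, ‹_›, ‹_›, ‹_›, ‹_›,
    A.boundaryData, A'.boundaryData, Diffeomorph.refl (𝓡 3) N ∞, ⟨Θ.symm⟩, ?_, ?_⟩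
  · exact hS W b f N X hFar V' A'
  · intro Φ hΦ
    refine hR W b f N X hInv V V' A A' ⟨Φ.symm, fun y => ?_⟩
    have h : Φ (A.jX (X.inr y)) = A'.jX (X.inr y) := hΦ y
    rw [← h, Diffeomorph.symm_apply_apply]

/-! ### Thm. A with the homeomorphism, Thm. B and the barrier without Freedman–Quinn -/

/-- **Akbulut–Ruberman 2016, Thm. A for contractible `W`, with "`V`, `V′` homeomorphic", from
the four parts of its printed proof.** Given a boundary diffeomorphism `f` of a compact
contractible `W` that extends to a self-homeomorphism (`hH`, Thm. A's "`F : W → W` a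
homeomorphism whose restriction to `∂W` is a diffeomorphism") but to no self-diffeomorphism
(`hD`), the `V`, `V′` of the construction have diffeomorphic boundaries, are HOMEOMORPHIC, and
are not diffeomorphic (Lemma 1.2, `isEmpty_diffeomorph_of_lemma12`, fed with the extension and
relative-exoticness properties). [cite: AkbulutRuberman2016, Thm. A and §3] -/
theorem akbulutRuberman2016_theoremA_contractible_homeomorph_of_parts
    (hC : akbulutRuberman2016_symmetryKillingCobordism.{u})
    (hG : exists_cobordismAttachment.{u})
    (hR : akbulutRuberman2016_relativelyExotic.{u})
    (hS : akbulutRuberman2016_boundaryDiffeosExtend.{u})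
    (W : Type u) [TopologicalSpace W] [T2Space W] [SecondCountableTopology W]
    [ChartedSpace (EuclideanHalfSpace 4) W] [IsManifold (𝓡∂ 4) ∞ W] [CompactSpace W]
    [ContractibleSpace W] (b : BoundaryData (𝓡∂ 4) W (𝓡 3))
    (f : b.carrier ≃ₘ⟮𝓡 3, 𝓡 3⟯ b.carrier) (hH : ExtendsToHomeomorph b f)
    (hD : ¬ ExtendsToDiffeomorph b f) :
    ∃ (V V' : Type u) (_ : TopologicalSpace V) (_ : T2Space V) (_ : SecondCountableTopology V)
      (_ : ChartedSpace (EuclideanHalfSpace 4) V) (_ : IsManifold (𝓡∂ 4) ∞ V) (_ : CompactSpace V)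
      (_ : ContractibleSpace V)
      (_ : TopologicalSpace V') (_ : T2Space V') (_ : SecondCountableTopology V')
      (_ : ChartedSpace (EuclideanHalfSpace 4) V') (_ : IsManifold (𝓡∂ 4) ∞ V')
      (_ : CompactSpace V') (_ : ContractibleSpace V')
      (bV : BoundaryData (𝓡∂ 4) V (𝓡 3)) (bV' : BoundaryData (𝓡∂ 4) V' (𝓡 3)),
      Nonempty (bV.carrier ≃ₘ⟮𝓡 3, 𝓡 3⟯ bV'.carrier) ∧ Nonempty (V ≃ₜ V') ∧
        IsEmpty (V ≃ₘ⟮𝓡∂ 4, 𝓡∂ 4⟯ V') := by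
  obtain ⟨V, V', _, _, _, _, _, _, _, _, _, _, _, _, _, _, bV, bV', ν, hT, hS', hR'⟩ :=
    akbulutRuberman2016_construction_homeomorph_of_parts hC hG hR hS W b f hH
  exact ⟨V, V', ‹_›, ‹_›, ‹_›, ‹_›, ‹_›, ‹_›, ‹_›, ‹_›, ‹_›, ‹_›, ‹_›, ‹_›, ‹_›, ‹_›, bV, bV', ⟨ν⟩,
    hT, isEmpty_diffeomorph_of_lemma12 bV bV' ν hS' fun Ψ hΨ => hD (hR' Ψ hΨ)⟩

/-- **Akbulut–Ruberman 2016, Thm. B from a cork and the four parts of Thm. A — no Freedman–Quinn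
hypothesis.** "Apply Theorem A to `(W, τ)`, a cork": the cork fact `akbulut1991_mazurCork`
(`hK`) supplies `W`, `b`, `f` with `f` extending to a self-homeomorphism but to no
self-diffeomorphism of `W`, and `akbulutRuberman2016_theoremA_contractible_homeomorph_of_parts`
the homeomorphic, non-diffeomorphic compact contractible pair with diffeomorphic boundaries.
[cite: AkbulutRuberman2016, Thm. B and its proof (§3)] [cite: Akbulut1991Fake, Thms. 1-2] -/
theorem akbulutRuberman2016_theoremB_of_cork_parts (hK : akbulut1991_mazurCork.{u})
    (hC : akbulutRuberman2016_symmetryKillingCobordism.{u})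
    (hG : exists_cobordismAttachment.{u})
    (hR : akbulutRuberman2016_relativelyExotic.{u})
    (hS : akbulutRuberman2016_boundaryDiffeosExtend.{u}) :
    akbulutRuberman2016_theoremB.{u} := by
  obtain ⟨W, _, _, _, _, _, _, _, b, f, hH, hD⟩ := hK
  obtain ⟨V, V', _, _, _, _, _, _, _, _, _, _, _, _, _, _, bV, bV', hB, hT, hE⟩ :=
    akbulutRuberman2016_theoremA_contractible_homeomorph_of_parts hC hG hR hS W b f hH hD
  exact ⟨V, V', ‹_›, ‹_›, ‹_›, ‹_›, ‹_›, ‹_›, ‹_›, ‹_›, ‹_›, ‹_›, ‹_›, ‹_›, ‹_›, ‹_›, bV, bV',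
    hB, hT, hE⟩

/-- **Thm. B from a cork, (C) and (R) alone** ((G) is the tree's theorem
`exists_cobordismAttachment_holds`, (S) is `akbulutRuberman2016_boundaryDiffeosExtend_holds`;
no Freedman–Quinn hypothesis). [cite: AkbulutRuberman2016, Thm. B and its proof (§3)] -/
theorem akbulutRuberman2016_theoremB_of_cork_symmetryKilling_relativelyExotic
    (hK : akbulut1991_mazurCork.{u})
    (hC : akbulutRuberman2016_symmetryKillingCobordism.{u})
    (hR : akbulutRuberman2016_relativelyExotic.{u}) :
    akbulutRuberman2016_theoremB.{u} :=
  akbulutRuberman2016_theoremB_of_cork_parts hK hC exists_cobordismAttachment_holds hR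
    akbulutRuberman2016_boundaryDiffeosExtend_holds

/-- **The barrier `ContractibleBarrierFour` from a cork, (C) and (R)** — the leaves of the
Akbulut–Ruberman route that remain named facts after this file; compare
`contractibleBarrierFour_of_cork_symmetryKilling_relativelyExotic_freedmanQuinn`
(`ExoticContractibleBoundaryDiffeosProofs.lean`), whose Freedman–Quinn hypothesis is dropped.
[cite: AkbulutRuberman2016, Thm. B and its proof (§3)] -/
theorem contractibleBarrierFour_of_cork_symmetryKilling_relativelyExotic
    (hK : akbulut1991_mazurCork.{u})
    (hC : akbulutRuberman2016_symmetryKillingCobordism.{u})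
    (hR : akbulutRuberman2016_relativelyExotic.{u}) :
    ContractibleBarrierFour.{u} :=
  contractibleBarrierFour_of_akbulutRuberman
    (akbulutRuberman2016_theoremB_of_cork_symmetryKilling_relativelyExotic hK hC hR)

/-- The same with the cork supplied in the tree's sense (`Literature.Topology.FourManifolds.IsCork`,
any cork on a second countable `W`), through `akbulut1991_mazurCork_of_isCork`.
[cite: AkbulutRuberman2016, §1 and proof of Thm. B] -/
theorem contractibleBarrierFour_of_isCork_symmetryKilling_relativelyExotic
    (h : ∃ (W : Type u) (_ : TopologicalSpace W) (_ : SecondCountableTopology W)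
      (_ : ChartedSpace (EuclideanHalfSpace 4) W) (_ : IsManifold (𝓡∂ 4) ∞ W)
      (b : BoundaryData (𝓡∂ 4) W (𝓡 3)) (τ : b.carrier ≃ₘ⟮𝓡 3, 𝓡 3⟯ b.carrier), IsCork b τ)
    (hC : akbulutRuberman2016_symmetryKillingCobordism.{u})
    (hR : akbulutRuberman2016_relativelyExotic.{u}) :
    ContractibleBarrierFour.{u} :=
  contractibleBarrierFour_of_cork_symmetryKilling_relativelyExotic (akbulut1991_mazurCork_of_isCork h)
    hC hR

end Literature.Barriers.SmoothPoincare4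

end
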